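import Literature.RingTheory.MvPolynomial.Directrix
import Literature.RingTheory.KrullDimension.AffineCatenary
import Mathlib.RingTheory.Ideal.KrullsHeightTheorem
import HarnessLib

/-!
# `e(S/I) ≤ dim(S/I)`: the directrix is contained in the cone (CJS Lemma 2.10 (1))

Topic: `Literature/RingTheory/MvPolynomial`. CJS, LNM 2270, Def. 2.8 and Lemma 2.10 (1): for a
homogeneous ideal `I ⊆ S = k[X_1, …, X_n]`, the directrix `Dir(S/I) = Spec(S/𝒯(I) S) ≅ 𝔸^{e(S/I)}`
is a closed subscheme of the cone `C(S/I) = Spec(S/I)` ("defined by the surjection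
`S/I ↠ S/𝒯(I) S`"), and "(1) `e(S/I)_K ≤ dim(S/I)`. … The inequality in (1) is trivial".

With `𝒯(I) = directrixSpace I` and `e(S/I) = directrixDim I = n - dim_k 𝒯(I)` from
`Directrix.lean` / `DirectrixExists.lean` we prove:

* `sub_C_constantCoeff_mem_span_of_mem_adjoin` — an element of `k[T]`, `T ⊆ S_1`, lies in the
  ideal `T · S` up to its constant term;
* **`le_span_directrixSpace`** — `I ⊆ 𝒯(I) · S` for every ideal `I` inside the irrelevant ideal
  (e.g. every proper homogeneous ideal): the surjection `S/I ↠ S/𝒯(I) S`, `Dir(S/I) ⊆ C(S/I)`;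
* **`natCast_directrixDim_le_ringKrullDim`** — **`e(S/I) ≤ dim S/I`** (CJS Lemma 2.10 (1)):
  `𝒯(I) · S` is generated by `r = dim_k 𝒯(I)` linear forms, so a minimal prime `P` over it has
  height `≤ r` (Krull) and `dim S/I ≥ dim S/P = n - ht P ≥ n - r` (dimension formula for the
  affine domain `S`, `Literature.RingTheory.KrullDimension.ringKrullDim_quotient_add_height`);
* `directrixSpace_eq_bot`, `directrixDim_bot` — if already `⊥` directs `I` (e.g. `I = 0`) then
  `𝒯(I) = 0` and `e(S/I) = n`;
* `directrixSpace_map_algEquiv`, `directrixDim_map_algEquiv` — `𝒯(θ I) = θ 𝒯(I)` and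
  `e(S/θ I) = e(S/I)` for graded automorphisms `θ` (invariance of the directrix, CJS Rem. 2.9 (a)).

## References

* V. Cossart, U. Jannsen, S. Saito, *Desingularization: Invariants and Strategy*, LNM 2270
  (2020), Ch. 2, Def. 2.8, Lemma 2.10 (1). [CossartJannsenSaito2020]
-/

noncomputable section

open MvPolynomial Finset Module
open Literature.RingTheory.KrullDimension

namespace Literature.RingTheory.MvPolynomial

universe u

variable {K : Type u} [Field K] {n : ℕ}

/-! ## `Dir(S/I) ⊆ C(S/I)`: `I ⊆ 𝒯(I) · S` -/

/-- Linear forms have no constant term. [folklore] -/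
theorem constantCoeff_eq_zero_of_isHomogeneous_one {t : MvPolynomial (Fin n) K}
    (ht : t.IsHomogeneous 1) : constantCoeff t = 0 := by
  rw [show constantCoeff t = coeff 0 t from congrFun constantCoeff_eq t]
  exact ht.coeff_eq_zero (by rw [map_zero]; exact zero_ne_one)

/-- An element of `k[T]`, `T` a space of linear forms, lies in the ideal `T · S` up to its
constant term: `f - f(0) ∈ T · S`. [folklore] -/
theorem sub_C_constantCoeff_mem_span_of_mem_adjoin {T : Submodule K (MvPolynomial (Fin n) K)}
    (hT : T ≤ homogeneousSubmodule (Fin n) K 1) {f : MvPolynomial (Fin n) K}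
    (hf : f ∈ Algebra.adjoin K (T : Set (MvPolynomial (Fin n) K))) :
    f - C (constantCoeff f) ∈ Ideal.span (T : Set (MvPolynomial (Fin n) K)) := by
  induction hf using Algebra.adjoin_induction with
  | mem t ht =>
    rw [constantCoeff_eq_zero_of_isHomogeneous_one (hT ht), C_0, sub_zero]
    exact Ideal.subset_span ht
  | algebraMap c =>
    rw [MvPolynomial.algebraMap_eq, constantCoeff_C, sub_self]
    exact zero_mem _
  | add p q _ _ hp hq =>
    rw [map_add, map_add, add_sub_add_comm]
    exact add_mem hp hq
  | mul p q _ _ hp hq =>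
    have h : p * q - C (constantCoeff (p * q)) =
        p * (q - C (constantCoeff q)) + C (constantCoeff q) * (p - C (constantCoeff p)) := by
      rw [map_mul, map_mul]
      ring
    rw [h]
    exact add_mem (Ideal.mul_mem_left _ _ hq) (Ideal.mul_mem_left _ _ hp)

variable {I : Ideal (MvPolynomial (Fin n) K)}

/-- If `T` directs an ideal `I` inside the irrelevant ideal, then `I ⊆ T · S`. [folklore] -/
theorem Directs.le_span {T : Submodule K (MvPolynomial (Fin n) K)} (h : Directs I T)
    (hI : I ≤ RingHom.ker (constantCoeff : MvPolynomial (Fin n) K →+* K)) :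
    I ≤ Ideal.span (T : Set (MvPolynomial (Fin n) K)) := by
  refine h.2.trans (Ideal.span_le.mpr ?_)
  rintro f ⟨hfI, hfT⟩
  have h0 : constantCoeff f = 0 := hI hfI
  have h1 := sub_C_constantCoeff_mem_span_of_mem_adjoin h.1 hfT
  rwa [h0, C_0, sub_zero] at h1

/-- **`Dir(S/I) ⊆ C(S/I)`, i.e. `I ⊆ 𝒯(I) · S`** for every ideal `I` contained in the irrelevant
ideal `(X_1, …, X_n)` (in particular every proper homogeneous ideal): the closed immersion behind
"the surjection `S/I ↠ S/𝒯(I) S`" of CJS Def. 2.8. [cite: CossartJannsenSaito2020, Def. 2.8] -/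
theorem le_span_directrixSpace
    (hI : I ≤ RingHom.ker (constantCoeff : MvPolynomial (Fin n) K →+* K)) :
    I ≤ Ideal.span (directrixSpace I : Set (MvPolynomial (Fin n) K)) :=
  (directs_directrixSpace I).le_span hI

/-! ## `e(S/I) ≤ dim S/I` -/

/-- A subspace `T` of linear forms of dimension `r` is contained in an ideal generated by at most
`r` linear forms (its basis). [folklore] -/
theorem exists_finset_span_le (T : Submodule K (MvPolynomial (Fin n) K))
    (hT : T ≤ homogeneousSubmodule (Fin n) K 1) :
    ∃ s : Finset (MvPolynomial (Fin n) K), s.card ≤ Module.finrank K T ∧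
      (∀ t ∈ s, t.IsHomogeneous 1) ∧
      Ideal.span (T : Set (MvPolynomial (Fin n) K)) ≤ Ideal.span (s : Set (MvPolynomial (Fin n) K)) := by
  classical
  haveI : FiniteDimensional K T := Submodule.finiteDimensional_of_le hT
  let b := Basis.ofVectorSpace K T
  set ι := Basis.ofVectorSpaceIndex K T
  haveI : Finite ι := Module.Finite.finite_basis b
  letI : Fintype ι := Fintype.ofFinite ι
  refine ⟨Finset.univ.image fun i : ι => ((b i : T) : MvPolynomial (Fin n) K), ?_, ?_, ?_⟩
  · rw [Module.finrank_eq_card_basis b]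
    exact Finset.card_image_le
  · intro t ht
    obtain ⟨i, -, rfl⟩ := Finset.mem_image.mp ht
    exact hT (b i).2
  · rw [Ideal.span_le]
    intro t ht
    -- `t` is a `k`-combination of the basis vectors
    have hrepr := b.sum_repr ⟨t, ht⟩
    have ht' : t = ∑ i, (b.repr ⟨t, ht⟩) i • ((b i : T) : MvPolynomial (Fin n) K) := by
      have := congrArg (Submodule.subtype T) hrepr.symm
      rw [map_sum] at this
      simpa using this
    rw [SetLike.mem_coe, ht']
    refine Ideal.sum_mem _ fun i _ => ?_
    rw [MvPolynomial.smul_eq_C_mul]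
    exact Ideal.mul_mem_left _ _ (Ideal.subset_span (Finset.mem_image_of_mem _ (Finset.mem_univ i)))

/-- **CJS Lemma 2.10 (1): `e(S/I) ≤ dim(S/I)`** for an ideal `I ⊆ S = k[X_1, …, X_n]` inside the
irrelevant ideal (e.g. a proper homogeneous ideal): the directrix `𝔸^{e(S/I)} ≅ Dir(S/I)` is a
closed subscheme of `C(S/I) = Spec(S/I)`. Proof: `I ⊆ 𝒯(I) · S ⊆ (t_1, …, t_r)` for a basis `t` of
`𝒯(I)`, a minimal prime `P ⊇ (t)` has `ht P ≤ r`, and `dim S/I ≥ dim S/P = n - ht P ≥ n - r`.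
[cite: CossartJannsenSaito2020, Lemma 2.10 (1)] -/
theorem natCast_directrixDim_le_ringKrullDim
    (hI : I ≤ RingHom.ker (constantCoeff : MvPolynomial (Fin n) K →+* K)) :
    (directrixDim I : WithBot ℕ∞) ≤ ringKrullDim (MvPolynomial (Fin n) K ⧸ I) := by
  classical
  obtain ⟨s, hscard, hs1, hTs⟩ := exists_finset_span_le (directrixSpace I) (directrixSpace_le_one I)
  set 𝔱 : Ideal (MvPolynomial (Fin n) K) := Ideal.span (s : Set (MvPolynomial (Fin n) K)) with h𝔱
  have hI𝔱 : I ≤ 𝔱 := (le_span_directrixSpace hI).trans hTs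
  -- `𝔱` is proper (inside the irrelevant ideal); take a minimal prime `P` over it
  have h𝔱le : 𝔱 ≤ RingHom.ker (constantCoeff : MvPolynomial (Fin n) K →+* K) :=
    Ideal.span_le.mpr fun t ht => by
      rw [SetLike.mem_coe, RingHom.mem_ker]
      exact constantCoeff_eq_zero_of_isHomogeneous_one (hs1 t ht)
  have h𝔱top : 𝔱 ≠ ⊤ := fun h => RingHom.ker_ne_top (constantCoeff : MvPolynomial (Fin n) K →+* K)
    (top_le_iff.mp (h ▸ h𝔱le))
  obtain ⟨⟨P, hP⟩⟩ := Ideal.nonempty_minimalPrimes h𝔱top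
  haveI hPprime : P.IsPrime := hP.1.1
  have h𝔱P : 𝔱 ≤ P := hP.1.2
  -- `ht P ≤ r ≤ dim_k 𝒯(I)`
  have hht : P.height ≤ s.card := Ideal.height_le_card_of_mem_minimalPrimes_span_finset hP
  obtain ⟨h, hh⟩ : ∃ h : ℕ, P.height = h :=
    ENat.ne_top_iff_exists.mp (ne_top_of_le_ne_top (ENat.coe_ne_top _) hht) |>.imp fun _ h => h.symm
  have hhr : h ≤ Module.finrank K (directrixSpace I) := by
    rw [hh] at hht
    exact (by exact_mod_cast hht : h ≤ s.card).trans hscard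
  -- the dimension formula `dim S/P + ht P = n` for the affine domain `S`
  obtain ⟨m, hm, -⟩ := exists_ringKrullDim_eq_and_trdeg_eq K (MvPolynomial (Fin n) K ⧸ P)
  have hformula := ringKrullDim_quotient_add_height K P
  rw [MvPolynomial.ringKrullDim_of_isNoetherianRing, ringKrullDim_eq_zero_of_field, zero_add,
    Nat.card_eq_fintype_card, Fintype.card_fin, hm, hh] at hformula
  have hmh : m + h = n := by exact_mod_cast hformula
  -- `dim S/I ≥ dim S/P = n - ht P ≥ n - dim_k 𝒯(I) = e(S/I)`
  have hquot : ringKrullDim (MvPolynomial (Fin n) K ⧸ P) ≤ ringKrullDim (MvPolynomial (Fin n) K ⧸ I) :=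
    ringKrullDim_le_of_surjective (Ideal.Quotient.factor (hI𝔱.trans h𝔱P))
      (Ideal.Quotient.factor_surjective _)
  rw [hm] at hquot
  refine le_trans ?_ hquot
  have hle : directrixDim I ≤ m := by
    unfold directrixDim
    omega
  exact_mod_cast hle

/-! ## The case `𝒯(I) = 0` -/

/-- If `⊥` directs `I` (`I` is generated by constants, e.g. `I = 0` or `I = S`) then `𝒯(I) = 0`.
[folklore] -/
theorem directrixSpace_eq_bot (h : Directs I ⊥) : directrixSpace I = ⊥ :=
  le_bot_iff.mp (directrixSpace_le h)

/-- The zero ideal is directed by `⊥`. [folklore] -/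
theorem directs_bot_bot : Directs (⊥ : Ideal (MvPolynomial (Fin n) K)) ⊥ :=
  ⟨bot_le, bot_le⟩

/-- **`e(S) = n`**: the directrix of the zero ideal (the cone `C(S) = 𝔸ⁿ`) is everything.
[cite: CossartJannsenSaito2020, Def. 2.8] -/
theorem directrixDim_bot : directrixDim (⊥ : Ideal (MvPolynomial (Fin n) K)) = n := by
  rw [directrixDim, directrixSpace_eq_bot directs_bot_bot, finrank_bot, Nat.sub_zero]


/-! ## Invariance under graded automorphisms -/

/-- **The directrix space is transported by graded automorphisms**: for a `k`-algebra automorphism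
`θ` of `S` preserving `S_1`, `𝒯(θ I) = θ(𝒯(I))`. [cite: CossartJannsenSaito2020, Lemma 2.7] -/
theorem directrixSpace_map_algEquiv (θ : MvPolynomial (Fin n) K ≃ₐ[K] MvPolynomial (Fin n) K)
    (hθ : ∀ f : MvPolynomial (Fin n) K, f.IsHomogeneous 1 → (θ f).IsHomogeneous 1)
    (hθ' : ∀ f : MvPolynomial (Fin n) K, f.IsHomogeneous 1 → (θ.symm f).IsHomogeneous 1)
    (I : Ideal (MvPolynomial (Fin n) K)) :
    directrixSpace (I.map (θ : MvPolynomial (Fin n) K →+* MvPolynomial (Fin n) K)) =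
      (directrixSpace I).map θ.toLinearMap := by
  refine le_antisymm (directrixSpace_le ((directs_directrixSpace I).map_algEquiv θ hθ)) ?_
  -- apply the same inequality to `θ⁻¹` and `θ I`
  have h := directrixSpace_le
    ((directs_directrixSpace (I.map (θ : MvPolynomial (Fin n) K →+* MvPolynomial (Fin n) K))).map_algEquiv
      θ.symm hθ')
  rw [map_map_symm_algEquiv] at h
  have h' := Submodule.map_mono (f := θ.toLinearMap) h
  have hback : ((directrixSpace (I.map (θ : MvPolynomial (Fin n) K →+* MvPolynomial (Fin n) K))).map
      θ.symm.toLinearMap).map θ.toLinearMap =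
      directrixSpace (I.map (θ : MvPolynomial (Fin n) K →+* MvPolynomial (Fin n) K)) := by
    have := map_map_symm_toLinearMap θ.symm
      (directrixSpace (I.map (θ : MvPolynomial (Fin n) K →+* MvPolynomial (Fin n) K)))
    rwa [AlgEquiv.symm_symm] at this
  rwa [hback] at h'

/-- **`e(S/θ I) = e(S/I)`** for a graded automorphism `θ` of `S` (the directrix dimension is an
invariant of the graded algebra `S/I`, cf. CJS Rem. 2.9 (a)). [cite: CossartJannsenSaito2020, Rem. 2.9 (a)] -/
theorem directrixDim_map_algEquiv (θ : MvPolynomial (Fin n) K ≃ₐ[K] MvPolynomial (Fin n) K)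
    (hθ : ∀ f : MvPolynomial (Fin n) K, f.IsHomogeneous 1 → (θ f).IsHomogeneous 1)
    (hθ' : ∀ f : MvPolynomial (Fin n) K, f.IsHomogeneous 1 → (θ.symm f).IsHomogeneous 1)
    (I : Ideal (MvPolynomial (Fin n) K)) :
    directrixDim (I.map (θ : MvPolynomial (Fin n) K →+* MvPolynomial (Fin n) K)) = directrixDim I := by
  rw [directrixDim, directrixDim, directrixSpace_map_algEquiv θ hθ hθ' I,
    LinearEquiv.finrank_eq (Submodule.equivMapOfInjective θ.toLinearMap θ.injective (directrixSpace I))]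

end Literature.RingTheory.MvPolynomial

end
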